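import Literature.MathematicalPhysics.QuantumFieldTheory.Balaban1983to89.B7Prop4Flat
import Literature.MathematicalPhysics.QuantumFieldTheory.Balaban1983to89.B7Prop2Explicit
import HarnessLib

/-!
# Line H (`BirthV10.stub_halvingStep`, stmt-QuantumFields-19200) — σ-EDITION (LEAD-H ★w5-19200 g7 WORD 24): THE SCALAR WINDOWS OF THE (b)-ROW CLOSURE
# `hStokesL_holds` (pen (σ9)), DISCHARGED FROM THE ρ5 MEMBER PREFIX — pure real arithmetic, c′-independent half (pen (i))

Cell `ym3-torus` (HUMAN RULING D-0037: YM₃ on T³ is ladder rung R3 — NOT d = 4, NOT infinite volume, NOT a mass gap, NOT the Clay problem), width seat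
`ym3-torus-px20` gen 5.  `--supports stmt-QuantumFields-19200 --as helper`; THEOREMS ONLY (0 `def`, 0 `sorry`); count-neutral; nothing here claims the
(b)-row, the stub, the crux or the gap.

WHAT.  The closure `hStokesL_holds : <✓p699278's binder `hStokesL` VERBATIM>` (LEAD-H WORD 23∕24) feeds px15 g4's member knit `hStokes_holds` (σ letters) whose
scalar windows must be read off the ρ5 member prefix: the prefix carries ONE smallness row
`hw : 10^29·L^12·(1+B₀+B₀⁻¹)²·((1+B₀'H)(1+B₂')(1+BG)(1+BR))^5·(1+cB9⁻¹)·((ρ′+M′+1)^3·ε₀) ≤ 1` and the letters `Cθ·(ρ′+M′+1) ≤ Cr`, `Cr·ε₁ ≤ ε₀`,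
`α₁ = 198·s + 27·s∕(L·B₀)` (`s := (ρ′+M′+1)·ε₀`), `cstar = 5·d·L·B₀·(ε₀+α₁)`, and binder (b) ends in `θb := d·L·α₁∕8`.
* §1 `master_of_hw` — from `hw`: `10^21·L^6·(1+B₀+B₀⁻¹)²·((ρ′+M′+1)·s) ≤ 1` (hence `10^21·L^6·s ≤ 1`);
* §2 the B-al-2 ∕ (R-P) ∕ door windows of ✓p701149 `HalvingHStokesRowShell.hStokes_holds_of_hG` at `d = 3` — `hε7 hδw hRw hσw hα3 hα2 hw1 hw2 hρk1` and `ε₁ ≤ 1`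
  from `10^21·L^6·s ≤ 1`, `ε₀ ≤ s` (`C0 3 = 226·224²`, `c2' 3 L = (14336L²)⁻¹`, `C2 3 = 160768`, `c4 3 = 160768⁻¹`, `δc = (6L+1)(4L−3) ≤ 24L²`,
  `R := 240(C2 3 + 40000·25)·δc²·ε₀² ≤ 1.61·10^11·L^4·ε₀²`), and the L-only `hA` (`33(14L−3) ≤ 20L^4`, `L ≥ 3`);
* §3 (sibling module `…HStokesRowClosureTheta`) THE θ-BUDGET (the located seam of `LOCATE-THETA-BUDGET-px20g5.md`, evidence #47): (a) `theta_budget` — with the closure's choice `4 ≤ Cθ`, `Cθ(ρ′+M′+1) ≤ Cr`,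
  `Cr·ε₁ ≤ ε₀` and ANY `θG ≤ 38·s`: `2·(d(M′+ρ′)(d(M′−1+4ρ′)(3ε₁+44R)+4R)) + 3θG ≤ d·L·α₁∕8` (`54·s + 4·s + 114·s ≤ 222.75·s`); (b) `thetaG_le_of_sigma` —
  in the σ-letter (`c′ ≤ cσ`, `cσ ≤ 2·(L·cstar)`, so `cσ ≤ 6240·L²·(1+B₀+B₀⁻¹)·s`) the k-uniform value `θG := 3·(23040·h⋆·w⋆ + 4800·w⋆²)` of
  ✓`HalvingEffGaugeLevelSeq.exists_levelSeq_rows_L` is `≤ s` once `h⋆ ≤ 261·L²·s` and `w⋆ ≤ 37·10^5·L^3·(1+B₀+B₀⁻¹)·s` (the shapes of ✓p700741's adapters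
  `stairSize_closedForm_le_mul_levelRatio` ∕ `omega_closedForm_le_mul_levelRatio`, fed by `hstar_le` ∕ `wstar_le` below) — i.e. `θG = O(s²)`, the cure's §3.
HONEST SCOPE.  Arithmetic only; every hypothesis is a prefix letter or a positivity; no lattice object appears.  The (b)-row, `hG`, the ω-row are NOT touched here.

References: T. Bałaban, CMP **98** (1985) 17–51 [Balaban1985Averaging] (Prop. 1 (51) p.26 — `C₀`, `c₂′`; Prop. 4 (129)–(135) pp.37–39 — `C₂`, `c₄`; (84)–(86)
pp.30–31); CMP **99** (1985) 75–102 [Balaban1985RegularSpaces] ((1.29) p.81, Prop. 3 (1.42) p.83, Thm 4 p.88).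
-/

set_option autoImplicit false

namespace Summit.QuantumFields.YangMills.Theorems.HalvingHStokesRowClosureWindows

open Literature.MathematicalPhysics.QuantumFieldTheory.Balaban1983to89
open B7Prop2Explicit (C0 c2') open B7Prop3Flat (C1) open B7Prop4Flat (C2 c4)

/-! ## §1 The master smallness read off the prefix window `hw` -/

/-- §1 ★ **MASTER SMALLNESS FROM THE PREFIX WINDOW.**  With `X₀ := 1 + B₀ + B₀⁻¹`, `n := ρ′+M′+1 ≥ 1`, `s := n·ε₀`:
`hw` ⇒ `10^21·ℓ^6·X₀²·(n·s) ≤ 1`. [cite: Balaban1985RegularSpaces, Thm 4 p.88, (1.42) p.83] -/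
theorem master_of_hw {ℓ B₀ B₀'H B₂' BG BR cB9 n ε₀ : ℝ} (hℓ : 1 ≤ ℓ) (hB₀ : 0 < B₀) (hB₀'H : 0 < B₀'H) (hB₂' : 0 ≤ B₂')
    (hBG : 0 ≤ BG) (hBR : 0 ≤ BR) (hcB9 : 0 < cB9) (hn : 1 ≤ n) (hε₀ : 0 ≤ ε₀)
    (hw : (10 : ℝ) ^ 29 * ℓ ^ 12 * (1 + B₀ + B₀⁻¹) ^ 2 * ((1 + B₀'H) * (1 + B₂') * (1 + BG) * (1 + BR)) ^ 5 * (1 + cB9⁻¹) *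
      (n ^ 3 * ε₀) ≤ 1) :
    (10 : ℝ) ^ 21 * ℓ ^ 6 * (1 + B₀ + B₀⁻¹) ^ 2 * (n * (n * ε₀)) ≤ 1 := by
  have hX : 1 ≤ 1 + B₀ + B₀⁻¹ := by have := (inv_pos.2 hB₀).le; linarith only [this, hB₀.le]
  have hY : 1 ≤ (1 + B₀'H) * (1 + B₂') * (1 + BG) * (1 + BR) := by
    have h1 : 1 ≤ 1 + B₀'H := by linarith only [hB₀'H.le]
    have h2 : 1 ≤ 1 + B₂' := by linarith only [hB₂']
    have h3 : 1 ≤ 1 + BG := by linarith only [hBG]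
    have h4 : 1 ≤ 1 + BR := by linarith only [hBR]
    exact one_le_mul_of_one_le_of_one_le (one_le_mul_of_one_le_of_one_le (one_le_mul_of_one_le_of_one_le h1 h2) h3) h4
  have hY5 : 1 ≤ ((1 + B₀'H) * (1 + B₂') * (1 + BG) * (1 + BR)) ^ 5 := one_le_pow₀ hY
  have hc : 1 ≤ 1 + cB9⁻¹ := by have := (inv_pos.2 hcB9).le; linarith only [this]
  have hn0 : 0 ≤ n := by linarith only [hn]
  have hℓ6 : ℓ ^ 6 ≤ ℓ ^ 12 := pow_le_pow_right₀ hℓ (by norm_num)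
  have hn23 : n * (n * ε₀) ≤ n ^ 3 * ε₀ := by
    have : n * n ≤ n ^ 3 := by nlinarith only [hn, hn0]
    nlinarith only [this, hε₀]
  calc (10 : ℝ) ^ 21 * ℓ ^ 6 * (1 + B₀ + B₀⁻¹) ^ 2 * (n * (n * ε₀))
      = (10 : ℝ) ^ 21 * ℓ ^ 6 * (1 + B₀ + B₀⁻¹) ^ 2 * 1 * 1 * (n * (n * ε₀)) := by ring
    _ ≤ (10 : ℝ) ^ 29 * ℓ ^ 12 * (1 + B₀ + B₀⁻¹) ^ 2 * ((1 + B₀'H) * (1 + B₂') * (1 + BG) * (1 + BR)) ^ 5 * (1 + cB9⁻¹) *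
          (n ^ 3 * ε₀) := by gcongr <;> norm_num
    _ ≤ 1 := hw

/-- §1 The master window without the `X₀²·n` weight: `10^21·ℓ^6·s ≤ 1`. [cite: Balaban1985RegularSpaces, Thm 4 p.88] -/
theorem small_of_master {ℓ X₀ n s : ℝ} (hX : 1 ≤ X₀) (hn : 1 ≤ n) (hs : 0 ≤ s)
    (hM : (10 : ℝ) ^ 21 * ℓ ^ 6 * X₀ ^ 2 * (n * s) ≤ 1) : (10 : ℝ) ^ 21 * ℓ ^ 6 * s ≤ 1 := by
  have hX2 : 1 ≤ X₀ ^ 2 := one_le_pow₀ hX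
  calc (10 : ℝ) ^ 21 * ℓ ^ 6 * s = (10 : ℝ) ^ 21 * ℓ ^ 6 * 1 * (1 * s) := by ring
    _ ≤ (10 : ℝ) ^ 21 * ℓ ^ 6 * X₀ ^ 2 * (n * s) := by gcongr
    _ ≤ 1 := hM

/-- §1 The master window with the `X₀²` weight only: `10^21·ℓ^6·X₀²·s ≤ 1`. [cite: Balaban1985RegularSpaces, Thm 4 p.88] -/
theorem smallX_of_master {ℓ X₀ n s : ℝ} (hn : 1 ≤ n) (hs : 0 ≤ s)
    (hM : (10 : ℝ) ^ 21 * ℓ ^ 6 * X₀ ^ 2 * (n * s) ≤ 1) : (10 : ℝ) ^ 21 * ℓ ^ 6 * X₀ ^ 2 * s ≤ 1 := by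
  calc (10 : ℝ) ^ 21 * ℓ ^ 6 * X₀ ^ 2 * s = (10 : ℝ) ^ 21 * ℓ ^ 6 * X₀ ^ 2 * (1 * s) := by ring
    _ ≤ (10 : ℝ) ^ 21 * ℓ ^ 6 * X₀ ^ 2 * (n * s) := by gcongr
    _ ≤ 1 := hM

/-- §1 A monomial reader: `a·ℓ^j·s ≤ 1` whenever `0 ≤ a ≤ 10^21`, `j ≤ 6`, `1 ≤ ℓ`, from `10^21·ℓ^6·s ≤ 1`. [folklore] -/
theorem mono_le_one {ℓ s a : ℝ} {j : ℕ} (hℓ : 1 ≤ ℓ) (hs : 0 ≤ s) (hS : (10 : ℝ) ^ 21 * ℓ ^ 6 * s ≤ 1)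
    (ha' : a ≤ (10 : ℝ) ^ 21) (hj : j ≤ 6) : a * ℓ ^ j * s ≤ 1 := by
  have hℓj : ℓ ^ j ≤ ℓ ^ 6 := pow_le_pow_right₀ hℓ hj
  calc a * ℓ ^ j * s ≤ (10 : ℝ) ^ 21 * ℓ ^ 6 * s := by gcongr
    _ ≤ 1 := hS

/-! ## §2 The B-al-2 ∕ (R-P) ∕ door windows of the member knit at `d = 3` -/

/-- §2 The numerals of the printed constants at `d = 3`: `C0 3 = 226·224²`, `c2' 3 L = 1∕(14336·L²)`, `C2 3 = 160768`, `c4 3 = 1∕160768`.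
[cite: Balaban1985Averaging, Prop. 1 (51) p.26, (133) p.38, Prop. 4 p.39] -/
theorem constants_three (L : ℕ) :
    C0 3 = 11339776 ∧ c2' 3 L = 1 / (14336 * (L : ℝ) ^ 2) ∧ C2 3 = 160768 ∧ c4 3 = 1 / 160768 := by
  refine ⟨?_, ?_, ?_, ?_⟩
  · unfold C0; norm_num
  · unfold c2'; norm_num
  · unfold C2 C1; norm_num
  · unfold c4 C1; norm_num

/-- §2 The B-al-2 count `δc = (2(dL)+1)(d(L−1)+L)` at `d = 3`, `L ≥ 1`: `δc = (6L+1)(4L−3) ≤ 24·L²`. [cite: Balaban1985Averaging, (84)-(86) pp.30-31] -/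
theorem deltaC_le (L : ℕ) (hL : 1 ≤ L) : (((2 * (3 * L) + 1) * (3 * (L - 1) + L) : ℕ) : ℝ) ≤ 24 * (L : ℝ) ^ 2 := by
  have hL0 : (0 : ℝ) ≤ (L : ℝ) := Nat.cast_nonneg _
  have e : (((2 * (3 * L) + 1) * (3 * (L - 1) + L) : ℕ) : ℝ) = (6 * (L : ℝ) + 1) * (4 * (L : ℝ) - 3) := by
    push_cast [Nat.cast_sub hL]; ring
  rw [e]; nlinarith only [hL0]

/-- §2 `δc ≥ 0` (a cast). [folklore] -/
theorem deltaC_nonneg (d L : ℕ) : (0 : ℝ) ≤ (((2 * (d * L) + 1) * (d * (L - 1) + L) : ℕ) : ℝ) := Nat.cast_nonneg _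

/-- §2 The B-al-2 remainder constant at `d = 3`: `R := 240(C2 3 + 40000·5²)·δc²·ε₀² ≤ 161·10^9·L^4·ε₀²`. [cite: Balaban1985Averaging, Prop. 4 (133)-(135) pp.38-39] -/
theorem R_le (L : ℕ) (hL : 1 ≤ L) (ε₀ : ℝ) :
    240 * (C2 3 + 40000 * (((3 : ℕ) : ℝ) + 2) ^ 2) * (((2 * (3 * L) + 1) * (3 * (L - 1) + L) : ℕ) : ℝ) ^ 2 * ε₀ ^ 2 ≤
      161 * 10 ^ 9 * (L : ℝ) ^ 4 * ε₀ ^ 2 := by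
  obtain ⟨-, -, hC2, -⟩ := constants_three L
  have hδ := deltaC_le L hL
  have hδ0 := deltaC_nonneg 3 L
  have hδ2 : (((2 * (3 * L) + 1) * (3 * (L - 1) + L) : ℕ) : ℝ) ^ 2 ≤ (24 * (L : ℝ) ^ 2) ^ 2 := pow_le_pow_left₀ hδ0 hδ 2
  have h3 : (((3 : ℕ) : ℝ) + 2) ^ 2 = 25 := by norm_num
  rw [hC2, h3]
  have hc : (240 : ℝ) * (160768 + 40000 * 25) * (24 * (L : ℝ) ^ 2) ^ 2 ≤ 161 * 10 ^ 9 * (L : ℝ) ^ 4 := by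
    have hL4 : (0 : ℝ) ≤ (L : ℝ) ^ 4 := by positivity
    have e : (240 : ℝ) * (160768 + 40000 * 25) * (24 * (L : ℝ) ^ 2) ^ 2 = 160464568320 * (L : ℝ) ^ 4 := by ring
    rw [e]; nlinarith only [hL4]
  calc (240 : ℝ) * (160768 + 40000 * 25) * (((2 * (3 * L) + 1) * (3 * (L - 1) + L) : ℕ) : ℝ) ^ 2 * ε₀ ^ 2
      ≤ 240 * (160768 + 40000 * 25) * (24 * (L : ℝ) ^ 2) ^ 2 * ε₀ ^ 2 := by gcongr
    _ ≤ 161 * 10 ^ 9 * (L : ℝ) ^ 4 * ε₀ ^ 2 := mul_le_mul_of_nonneg_right hc (by positivity)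

/-- §2 ★ **THE REMAINDER IN THE MASTER WINDOW**: with `ε₀ ≤ s`, `10^21·L^6·s ≤ 1`, `L ≥ 1`, `n ≥ 1`, `n·ε₀ ≤ s`:
`R ≤ s`, `n·R ≤ s`, `n²·R ≤ 10⁻⁹·s` and `0 ≤ R`. [cite: Balaban1985Averaging, Prop. 4 (133)-(135) pp.38-39] -/
theorem R_small (L : ℕ) (hL : 1 ≤ L) {ε₀ s n : ℝ} (hε₀ : 0 ≤ ε₀) (hεs : ε₀ ≤ s) (hn : 1 ≤ n) (hns : n * ε₀ ≤ s)
    (hS : (10 : ℝ) ^ 21 * (L : ℝ) ^ 6 * s ≤ 1) :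
    0 ≤ 240 * (C2 3 + 40000 * (((3 : ℕ) : ℝ) + 2) ^ 2) * (((2 * (3 * L) + 1) * (3 * (L - 1) + L) : ℕ) : ℝ) ^ 2 * ε₀ ^ 2 ∧
    240 * (C2 3 + 40000 * (((3 : ℕ) : ℝ) + 2) ^ 2) * (((2 * (3 * L) + 1) * (3 * (L - 1) + L) : ℕ) : ℝ) ^ 2 * ε₀ ^ 2 ≤ s ∧
    n * (240 * (C2 3 + 40000 * (((3 : ℕ) : ℝ) + 2) ^ 2) * (((2 * (3 * L) + 1) * (3 * (L - 1) + L) : ℕ) : ℝ) ^ 2 * ε₀ ^ 2) ≤ s ∧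
    n ^ 2 * (240 * (C2 3 + 40000 * (((3 : ℕ) : ℝ) + 2) ^ 2) * (((2 * (3 * L) + 1) * (3 * (L - 1) + L) : ℕ) : ℝ) ^ 2 * ε₀ ^ 2) ≤ s / 10 ^ 9 := by
  obtain ⟨-, -, hC2, -⟩ := constants_three L
  have hR := R_le L hL ε₀
  set R := 240 * (C2 3 + 40000 * (((3 : ℕ) : ℝ) + 2) ^ 2) * (((2 * (3 * L) + 1) * (3 * (L - 1) + L) : ℕ) : ℝ) ^ 2 * ε₀ ^ 2 with hRdef
  have hR0 : 0 ≤ R := by rw [hRdef, hC2]; positivity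
  have hℓ1 : (1 : ℝ) ≤ (L : ℝ) := by exact_mod_cast hL
  have hs0 : 0 ≤ s := hε₀.trans hεs
  have hn0 : 0 ≤ n := by linarith only [hn]
  -- `10^21·L^6·s ≤ 1` ⇒ `161·10^9·L^4·s ≤ 10⁻⁹`-class
  have hL4s : 161 * 10 ^ 9 * (L : ℝ) ^ 4 * s * 10 ^ 9 ≤ 1 := by
    have h := mono_le_one hℓ1 hs0 hS (a := 161 * 10 ^ 18) (j := 4) (by norm_num) (by norm_num)
    linarith only [h]
  -- n²R ≤ 161e9 L^4 (nε₀)² ≤ 161e9 L^4 s²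
  have hn2R : n ^ 2 * R ≤ 161 * 10 ^ 9 * (L : ℝ) ^ 4 * s * s := by
    have h1 : n ^ 2 * R ≤ n ^ 2 * (161 * 10 ^ 9 * (L : ℝ) ^ 4 * ε₀ ^ 2) := mul_le_mul_of_nonneg_left hR (by positivity)
    have h2 : n ^ 2 * (161 * 10 ^ 9 * (L : ℝ) ^ 4 * ε₀ ^ 2) = 161 * 10 ^ 9 * (L : ℝ) ^ 4 * (n * ε₀) ^ 2 := by ring
    have h3 : (n * ε₀) ^ 2 ≤ s ^ 2 := pow_le_pow_left₀ (by positivity) hns 2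
    have h4 : 161 * 10 ^ 9 * (L : ℝ) ^ 4 * (n * ε₀) ^ 2 ≤ 161 * 10 ^ 9 * (L : ℝ) ^ 4 * s ^ 2 := mul_le_mul_of_nonneg_left h3 (by positivity)
    nlinarith only [h1, h2, h4]
  have hkey : n ^ 2 * R ≤ s / 10 ^ 9 := by
    rw [le_div_iff₀ (by norm_num : (0 : ℝ) < 10 ^ 9)]
    have := mul_le_mul_of_nonneg_right hL4s hs0
    nlinarith only [hn2R, this, hs0]
  have hn2 : 1 ≤ n ^ 2 := one_le_pow₀ hn
  have hnR : n * R ≤ s := by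
    have h1 : n * R ≤ n ^ 2 * R := by rw [pow_two]; exact mul_le_mul_of_nonneg_right (le_mul_of_one_le_left hn0 hn) hR0
    have h2 : s / 10 ^ 9 ≤ s := div_le_self hs0 (by norm_num)
    linarith only [h1, hkey, h2]
  have hRs : R ≤ s := by
    have h1 : R ≤ n * R := le_mul_of_one_le_left hR0 hn
    exact h1.trans hnR
  exact ⟨hR0, hRs, hnR, hkey⟩

/-- §2 ★★ **THE KNIT's ε₀-WINDOWS AT d = 3** (✓p701149 `hStokes_holds_of_hG`'s `hε7 hδw hRw hσw hα3 hα2 hw1 hw2`, in the generic letters `d L`, `d = 3`),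
from `L ≥ 3`, `0 ≤ ε₀ ≤ s`, `10^21·L^6·s ≤ 1`. [cite: Balaban1985Averaging, Prop. 1 (51) p.26, Prop. 4 (129)-(135) pp.37-39] -/
theorem knit_windows (d L : ℕ) (hd : d = 3) (hL : 3 ≤ L) {ε₀ s : ℝ} (hε₀ : 0 ≤ ε₀) (hεs : ε₀ ≤ s)
    (hS : (10 : ℝ) ^ 21 * (L : ℝ) ^ 6 * s ≤ 1) :
    10 ^ 7 * (L : ℝ) ^ 3 * ε₀ ≤ 1 ∧
    (((2 * (d * L) + 1) * (d * (L - 1) + L) : ℕ) : ℝ) * (4 * ε₀) ≤ 1 / 200 ∧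
    (240 * (C2 d + 40000 * ((d : ℝ) + 2) ^ 2) * (((2 * (d * L) + 1) * (d * (L - 1) + L) : ℕ) : ℝ) ^ 2 * ε₀ ^ 2) ≤ 1 / 200 ∧
    600 * (((d + 2) * L : ℕ) : ℝ) * ((((2 * (d * L) + 1) * (d * (L - 1) + L) : ℕ) : ℝ) * (4 * ε₀) +
      102 / 100 * (240 * (C2 d + 40000 * ((d : ℝ) + 2) ^ 2) * (((2 * (d * L) + 1) * (d * (L - 1) + L) : ℕ) : ℝ) ^ 2 * ε₀ ^ 2)) ≤ 1 ∧
    C0 d * (2 * ε₀) ≤ 1 / 3 ∧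
    2 * (2 * ε₀) ≤ c2' d L ∧
    10 ^ 4 * (((d + 2) * L : ℕ) : ℝ) * ((((2 * (d * L) + 1) * (d * (L - 1) + L) : ℕ) : ℝ) * (4 * ε₀) +
      2 * (240 * (C2 d + 40000 * ((d : ℝ) + 2) ^ 2) * (((2 * (d * L) + 1) * (d * (L - 1) + L) : ℕ) : ℝ) ^ 2 * ε₀ ^ 2)) ≤ 1 ∧
    (L : ℝ) * (2 * ((((2 * (d * L) + 1) * (d * (L - 1) + L) : ℕ) : ℝ) * (4 * ε₀))) ≤ c4 d := by
  subst hd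
  have hL1 : 1 ≤ L := le_trans (by norm_num) hL
  obtain ⟨hC0, hc2, hC2, hc4⟩ := constants_three L
  obtain ⟨hR0, hRs, -, -⟩ := R_small L hL1 hε₀ hεs le_rfl (by rw [one_mul]; exact hεs) hS
  set R := 240 * (C2 3 + 40000 * (((3 : ℕ) : ℝ) + 2) ^ 2) * (((2 * (3 * L) + 1) * (3 * (L - 1) + L) : ℕ) : ℝ) ^ 2 * ε₀ ^ 2 with hRdef
  have hδ := deltaC_le L hL1
  have hδ0 := deltaC_nonneg 3 L
  set δc : ℝ := (((2 * (3 * L) + 1) * (3 * (L - 1) + L) : ℕ) : ℝ) with hδdef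
  have hℓ3 : (3 : ℝ) ≤ (L : ℝ) := by exact_mod_cast hL
  have hℓ1 : (1 : ℝ) ≤ (L : ℝ) := by linarith only [hℓ3]
  have hℓ0 : (0 : ℝ) ≤ (L : ℝ) := by linarith only [hℓ3]
  have hs0 : 0 ≤ s := hε₀.trans hεs
  have e5 : (((3 + 2) * L : ℕ) : ℝ) = 5 * (L : ℝ) := by push_cast; ring
  -- the monomials used
  have m3 : 10 ^ 7 * (L : ℝ) ^ 3 * s ≤ 1 := mono_le_one hℓ1 hs0 hS (by norm_num) (by norm_num)
  have m2 : 10 ^ 8 * (L : ℝ) ^ 2 * s ≤ 1 := mono_le_one hℓ1 hs0 hS (by norm_num) (by norm_num)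
  have m0 : 10 ^ 9 * (L : ℝ) ^ 0 * s ≤ 1 := mono_le_one hℓ1 hs0 hS (by norm_num) (by norm_num)
  rw [pow_zero, mul_one] at m0
  -- δc·4ε₀ ≤ 96 L² s
  have hδε : δc * (4 * ε₀) ≤ 96 * (L : ℝ) ^ 2 * s := by
    have := mul_le_mul hδ (mul_le_mul_of_nonneg_left hεs (by norm_num : (0:ℝ) ≤ 4)) (by positivity) (by positivity)
    linarith only [this]
  have hL2s : (L : ℝ) ^ 2 * s ≤ (L : ℝ) ^ 3 * s := by
    have : (L : ℝ) ^ 2 ≤ (L : ℝ) ^ 3 := pow_le_pow_right₀ hℓ1 (by norm_num)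
    exact mul_le_mul_of_nonneg_right this hs0
  have hsL3 : s ≤ (L : ℝ) ^ 3 * s := le_mul_of_one_le_left hs0 (one_le_pow₀ hℓ1)
  refine ⟨?_, ?_, ?_, ?_, ?_, ?_, ?_, ?_⟩
  · -- hε7
    have := mul_le_mul_of_nonneg_left hεs (by positivity : (0 : ℝ) ≤ 10 ^ 7 * (L : ℝ) ^ 3)
    linarith only [this, m3]
  · -- hδw
    linarith only [hδε, m2]
  · -- hRw
    linarith only [hRs, m0]
  · -- hσw
    rw [e5]
    have h1 : δc * (4 * ε₀) + 102 / 100 * R ≤ 98 * (L : ℝ) ^ 3 * s := by linarith only [hδε, hRs, hL2s, hsL3, hs0]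
    have h2 := mul_le_mul_of_nonneg_left h1 (by positivity : (0 : ℝ) ≤ 600 * (5 * (L : ℝ)))
    have h3 : 600 * (5 * (L : ℝ)) * (98 * (L : ℝ) ^ 3 * s) = 294000 * ((L : ℝ) ^ 4 * s) := by ring
    have m4 : 294000 * (L : ℝ) ^ 4 * s ≤ 1 := mono_le_one hℓ1 hs0 hS (by norm_num) (by norm_num)
    linarith only [h2, h3, m4]
  · -- hα3
    rw [hC0]; linarith only [hεs, m0]
  · -- hα2
    rw [hc2, le_div_iff₀ (by positivity)]
    nlinarith only [hεs, m2, hℓ0]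
  · -- hw1
    rw [e5]
    have h1 : δc * (4 * ε₀) + 2 * R ≤ 98 * (L : ℝ) ^ 3 * s := by linarith only [hδε, hRs, hL2s, hsL3, hs0]
    have h2 := mul_le_mul_of_nonneg_left h1 (by positivity : (0 : ℝ) ≤ 10 ^ 4 * (5 * (L : ℝ)))
    have h3 : 10 ^ 4 * (5 * (L : ℝ)) * (98 * (L : ℝ) ^ 3 * s) = 4900000 * ((L : ℝ) ^ 4 * s) := by ring
    have m4 : 4900000 * (L : ℝ) ^ 4 * s ≤ 1 := mono_le_one hℓ1 hs0 hS (by norm_num) (by norm_num)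
    linarith only [h2, h3, m4]
  · -- hw2
    rw [hc4, le_div_iff₀ (by norm_num)]
    have h1 : (L : ℝ) * (2 * (δc * (4 * ε₀))) ≤ 192 * ((L : ℝ) ^ 3 * s) := by
      have := mul_le_mul_of_nonneg_left hδε (by positivity : (0 : ℝ) ≤ 2 * (L : ℝ))
      nlinarith only [this]
    have m4 : 192 * 160768 * (L : ℝ) ^ 3 * s ≤ 1 := mono_le_one hℓ1 hs0 hS (by norm_num) (by norm_num)
    nlinarith only [h1, m4]

/-- §2 ★ **THE L-ONLY WINDOW `hA`** of LEMMA B-al-2 (`33·(2((d+2)L) + L + 2(d((L−1)∕2))) ≤ 20·L^4`) at `d = 3` for every `L ≥ 3`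
(`33·(14L − 3) ≤ 462·L ≤ 540·L ≤ 20·L^4`; false at `L = 1`, as px15 g4 noted). [cite: Balaban1985Averaging, Prop. 4 (134)-(135) pp.38-39] -/
theorem window_A (d L : ℕ) (hd : d = 3) (hL : 3 ≤ L) :
    33 * (2 * ((((d + 2) * L : ℕ) : ℝ)) + (L : ℝ) + 2 * (((d * ((L - 1) / 2)) : ℕ) : ℝ)) ≤ 20 * (L : ℝ) ^ 4 := by
  subst hd
  have hL1 : 1 ≤ L := le_trans (by norm_num) hL
  have hℓ3 : (3 : ℝ) ≤ (L : ℝ) := by exact_mod_cast hL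
  have e5 : (((3 + 2) * L : ℕ) : ℝ) = 5 * (L : ℝ) := by push_cast; ring
  have hhalf : (((3 * ((L - 1) / 2)) : ℕ) : ℝ) ≤ 3 * (((L : ℝ) - 1) / 2) := by
    have h1 : (((L - 1) / 2 : ℕ) : ℝ) ≤ (((L - 1 : ℕ) : ℝ)) / 2 := Nat.cast_div_le
    rw [Nat.cast_sub hL1, Nat.cast_one] at h1
    push_cast; linarith only [h1]
  rw [e5]
  have hL4 : 27 * (L : ℝ) ≤ (L : ℝ) ^ 4 := by
    have h3 : (L : ℝ) ^ 3 ≥ 27 := by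
      have := pow_le_pow_left₀ (by norm_num : (0:ℝ) ≤ 3) hℓ3 3; norm_num at this; exact this
    nlinarith only [h3, hℓ3]
  nlinarith only [hhalf, hL4, hℓ3]

end Summit.QuantumFields.YangMills.Theorems.HalvingHStokesRowClosureWindows
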